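/-
Copyright (c) 2026 the pub-hodgecm-mathlib formalisation cell (harness21).  Prover seat hodgecm-mathlib-K2E3-p27 (g0), HCML Track B «K2-LIT» ∕ h413
(`stmt-HodgeConjecture-24833`), line `K2_E3_EllipticInputs`, unit U12 «Characters», PART «RANK» leaf (11-2qs-Id′) ∕ (qs2-ps) «van Dijk₂», deal D117 (HCD₂)
(dealer K2E3-plan (g4)), FILE 2a OF 4 «HCD₂-CAYLEY ALGEBRA»: the `2 × 2` Weyl ratio `‖disc χ_M‖·‖det M‖⁻¹` — scalar invariance, its reading through the Cayley map
`disc χ_{c(X)}·det(1 − X)² = 4·disc χ_X`, and the `ℝ≥0∞` bound `θ₂(z • c X) ≤ C(X)·ηι(X)` (the `2 × 2` twin of ★ `F0P3cStCharTSHCDGroupToLie` §1–§2).  2026-09-04.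
-/
import Summits.HodgeConjecture.HodgeConjecture.Theorems.F0P3cStCharTSHCDCayleyChartAt   -- ★ (D6a)+(D6c) (F0P3a-p06): `exists_depth_lintegral_translate_eq` (ANY matrix size), `isClosedEmbedding_subtype`
import Literature.LinearAlgebra.Matrix.CayleyCharpolyDiscr                                -- ★ D6(b) p851997 (F0P2-p06): generic `charpoly_cayley_mul_C_det`, `det_cayley_mul_det`
import Literature.NumberTheory.Automorphic.LocalFieldHaarBalls                            -- ★ `LocalFieldHaar.continuous_normAbs`
import Mathlib.LinearAlgebra.Matrix.Charpoly.Disc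
import Mathlib.MeasureTheory.Measure.Haar.MulEquivHaarChar
import Mathlib.Topology.Algebra.Ring.Real
import HarnessLib

/-!
# Deal D117 (HCD₂), FILE 2a «HCD₂-CAYLEY ALGEBRA»: the `2 × 2` Weyl ratio through the Cayley map and the bound `θ₂(z • c X) ≤ C(X)·ηι(X)`
# (Harish-Chandra 1970 Part VII §1 Thm. 15, `2 × 2`; the algebra half of the `G → 𝔤` step)

Cell `pub/hodgecm-mathlib` (D-0151), Track B «K2-LIT», crux H413 = `stmt-HodgeConjecture-24833`, route `HCCMUnconditional`.  Lane `--supports stmt-HodgeConjecture-24833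
--as helper`; THEOREMS ONLY (no `def`, no `instance`, no `notation`, no named-fact hypothesis, no `sorry`); count-neutral.  The `2 × 2` twin, token for token with `3 ↦ 2`
and the `det`-exponent `2 ↦ 1` (`|D_G| = |disc χ_g| ∕ |det g|^{n−1}`), of ★ `F0P3cStCharTSHCDGroupToLie` (F0P3a-p06 (g21)); the chart theorem ★ `exists_depth_lintegral_translate_eq`
it threads is generic in the matrix size and is used BY NAME.

THE MATHEMATICS.  On the Lie algebra the integrand is `ηι X := (↑√√‖disc χ_X‖_K)⁻¹`, on the group `θ₂ M := (↑√√(‖disc χ_M‖_K · ‖det M‖_K⁻¹))⁻¹` — the one-place reading of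
`|D_G|^{−1∕2}` for `U(1,1)`.  §1 For `2 × 2` matrices `disc χ_{zM} = z² disc χ_M`, `det(zM) = z² det M`, so the Weyl ratio `‖disc χ_M‖·‖det M‖⁻¹` is invariant under
non-zero scalars; through the Cayley map `c(X) = (1 + X)(1 − X)⁻¹` one has `disc χ_{c(X)} · det(1 − X)² = 4 · disc χ_X` (coefficient comparison in
`χ_{c(X)}·det(1 − X) = (T − 1)² − tr X·(T − 1)(T + 1) + det X·(T + 1)²`, ★ generic `charpoly_cayley_mul_C_det`) and `det c(X) · det(1 − X) = det(1 + X)`, hence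
`(‖disc χ_{c X}‖·‖det c X‖⁻¹)·‖det(1 − X)det(1 + X)‖ = ‖2‖²·‖disc χ_X‖`.  §2 (`ℝ≥0∞` bookkeeping) **`θ₂(z • c(X)) ≤ C(X) · ηι(X)`**, `C(X) = √√‖det(1−X)det(1+X)‖ ∕ √‖2‖`.
The sequel FILE 2b «HCD₂-G→𝔤» (`K2E3U11WeylDiscrGroupToLie`) adds §3 (measurability of the two integrands) and §4 the HEAD `exists_nhds_setLIntegral_theta_two_lt_top`
(group ⟸ Lie through ★ `exists_depth_lintegral_translate_eq`); split off for the 400-line rule.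

HONEST LABEL: HC_CM is proved only modulo the 7 printed citations (2 remaining named inputs: hLiu418 = stmt-HodgeConjecture-24832, h413 = stmt-HodgeConjecture-24833) until rung 0
closes; count-neutral helper; closes no socket by itself.

## References
* [HarishChandra1970] Harish-Chandra, *Harmonic analysis on reductive p-adic groups*, LNM 162 (1970), Part VII §1 Thm. 15.
* [Rogawski1990] J. D. Rogawski, *Automorphic Representations of Unitary Groups in Three Variables* (1990), §4.9 p. 54 (`D_G`), §12.5 p. 182.
* [PlatonovRapinchuk1994] V. Platonov, A. Rapinchuk, *Algebraic Groups and Number Theory* (1994), §3.3 (the Cayley transform).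
* [BasuPollackRoy2006] S. Basu, R. Pollack, M.-F. Roy, *Algorithms in Real Algebraic Geometry*, 2nd ed. (2006), §4.1 (discriminants).
-/

set_option autoImplicit false
set_option linter.dupNamespace false

noncomputable section

open Set Filter MeasureTheory MeasureTheory.Measure TopologicalSpace Topology Matrix ValuativeRel Metric Polynomial
open Literature.NumberTheory.Automorphic Literature.NumberTheory.Weil1982.UnitaryFinTopForm Literature.LinearAlgebra.Matrix
open Literature.NumberTheory.GaloisRepresentations.IsNonarchimedeanLocalField
open Summit.HodgeConjecture.HodgeConjecture.Cruxes.H413.F0P3cStCharTSHCDCayleyChartAt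
open scoped Pointwise Topology ENNReal NNReal MatrixGroups

namespace Summit.HodgeConjecture.HodgeConjecture.Cruxes.H413.K2E3U11WeylDiscrCayleyAlgebra

/-! ## §1 The Weyl ratio of a `2 × 2` matrix: scalar invariance and the Cayley reading -/

section Ring

variable {R : Type*} [CommRing R]

/-- **Homogeneity of the quadratic discriminant**: `discr χ_{cM} = c² · discr χ_M` for a `2 × 2` matrix (`disc = tr² − 4 det`, Mathlib `Matrix.discr_fin_two`).
[cite: Rogawski1990, §4.9 p. 54] -/
theorem discr_charpoly_smul_fin_two (c : R) (M : Matrix (Fin 2) (Fin 2) R) :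
    (c • M).charpoly.discr = c ^ 2 * M.charpoly.discr := by
  rw [← Matrix.discr, ← Matrix.discr, Matrix.discr_fin_two, Matrix.discr_fin_two, Matrix.trace_smul, Matrix.det_smul, Fintype.card_fin, smul_eq_mul]
  ring

/-- `det(1 + M) = 1 + tr M + det M` for a `2 × 2` matrix. [cite: BasuPollackRoy2006, §4.1] -/
theorem det_one_add_fin_two (M : Matrix (Fin 2) (Fin 2) R) : (1 + M).det = 1 + M.trace + M.det := by
  rw [Matrix.det_fin_two, Matrix.det_fin_two, Matrix.trace_fin_two]
  simp only [Matrix.add_apply, Matrix.one_apply_eq, Matrix.one_apply_ne (by decide : (0 : Fin 2) ≠ 1), Matrix.one_apply_ne (by decide : (1 : Fin 2) ≠ 0)]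
  ring

/-- `det(1 − M) = 1 − tr M + det M` for a `2 × 2` matrix. [cite: BasuPollackRoy2006, §4.1] -/
theorem det_one_sub_fin_two (M : Matrix (Fin 2) (Fin 2) R) : (1 - M).det = 1 - M.trace + M.det := by
  rw [Matrix.det_fin_two, Matrix.det_fin_two, Matrix.trace_fin_two]
  simp only [Matrix.sub_apply, Matrix.one_apply_eq, Matrix.one_apply_ne (by decide : (0 : Fin 2) ≠ 1), Matrix.one_apply_ne (by decide : (1 : Fin 2) ≠ 0)]
  ring

/-- The homogeneous form `det((T − 1)·1 − (T + 1)·M) = (T − 1)² − tr M·(T − 1)(T + 1) + det M·(T + 1)²` over `R[T]` (`2 × 2`). [cite: BasuPollackRoy2006, §4.1] -/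
theorem det_smul_one_sub_smul_map_fin_two (M : Matrix (Fin 2) (Fin 2) R) :
    ((X - 1 : R[X]) • (1 : Matrix (Fin 2) (Fin 2) R[X]) - (X + 1 : R[X]) • M.map C).det =
      (X - 1) ^ 2 - C M.trace * ((X - 1) * (X + 1)) + C M.det * (X + 1) ^ 2 := by
  rw [Matrix.det_fin_two, Matrix.det_fin_two, Matrix.trace_fin_two]
  simp only [Matrix.sub_apply, Matrix.smul_apply, Matrix.map_apply, Matrix.one_apply_eq, Matrix.one_apply_ne (by decide : (0 : Fin 2) ≠ 1),
    Matrix.one_apply_ne (by decide : (1 : Fin 2) ≠ 0), smul_eq_mul, mul_one, mul_zero, map_add, map_sub, map_mul]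
  ring

/-- **The characteristic polynomial of the Cayley transform of a `2 × 2` matrix**: for `det(1 − X)` a unit,
`χ_{c(X)} · det(1 − X) = (T − 1)² − tr X·(T − 1)(T + 1) + det X·(T + 1)²` (★ generic `charpoly_cayley_mul_C_det` + the `2 × 2` homogeneous form).
[cite: PlatonovRapinchuk1994, §3.3] [cite: BasuPollackRoy2006, §4.1] -/
theorem charpoly_cayley_mul_C_det_fin_two (A : Matrix (Fin 2) (Fin 2) R) (h : IsUnit (1 - A).det) :
    ((1 + A) * (1 - A)⁻¹).charpoly * C (1 - A).det = (X - 1) ^ 2 - C A.trace * ((X - 1) * (X + 1)) + C A.det * (X + 1) ^ 2 := by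
  rw [charpoly_cayley_mul_C_det A h, det_smul_one_sub_smul_map_fin_two]

/-- Coefficient comparison: `tr c(A) · det(1 − A) = 2 − 2 det A` (the `T¹`-coefficient of the identity above; `χ = T² − tr·T + det`, Mathlib `Matrix.charpoly_fin_two`).
[cite: BasuPollackRoy2006, §4.1] -/
theorem trace_cayley_mul_det_fin_two (A : Matrix (Fin 2) (Fin 2) R) (h : IsUnit (1 - A).det) :
    ((1 + A) * (1 - A)⁻¹).trace * (1 - A).det = 2 - 2 * A.det := by
  nontriviality R
  have hq := charpoly_cayley_mul_C_det_fin_two A h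
  rw [Matrix.charpoly_fin_two] at hq
  have h1 := congrArg (fun p : R[X] => p.coeff 1) hq
  simp only [coeff_mul_C, coeff_add, coeff_sub, coeff_C_mul, coeff_X_pow, coeff_C, coeff_mul_X,
    show ((X - 1 : R[X]) ^ 2) = X ^ 2 - C 2 * X + C 1 by simp only [map_ofNat, map_one]; ring,
    show ((X - 1 : R[X]) * (X + 1)) = X ^ 2 - C 1 by simp only [map_one]; ring,
    show ((X + 1 : R[X]) ^ 2) = X ^ 2 + C 2 * X + C 1 by simp only [map_ofNat, map_one]; ring] at h1
  norm_num at h1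
  linear_combination -h1

/-- **`disc χ_{c(X)} · det(1 − X)² = 4 · disc χ_X`** for a `2 × 2` matrix with `det(1 − X)` a unit (the roots of `χ_{c(X)}` are `(1 + λᵢ)∕(1 − λᵢ)`:
`(μ₁ − μ₂)² = 4(λ₁ − λ₂)² ∕ det(1 − X)²; proved denominator-free: `disc = tr² − 4det`, `tr c(X)·det(1−X) = 2 − 2det X`, `det c(X)·det(1−X) = det(1+X) = 1 + tr X + det X`,
`det(1−X) = 1 − tr X + det X`). [cite: BasuPollackRoy2006, §4.1] [cite: PlatonovRapinchuk1994, §3.3] -/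
theorem discr_charpoly_cayley_mul_det_sq_fin_two (A : Matrix (Fin 2) (Fin 2) R) (h : IsUnit (1 - A).det) :
    ((1 + A) * (1 - A)⁻¹).charpoly.discr * (1 - A).det ^ 2 = 4 * A.charpoly.discr := by
  rw [← Matrix.discr, ← Matrix.discr, Matrix.discr_fin_two, Matrix.discr_fin_two]
  have ht := trace_cayley_mul_det_fin_two A h
  have hd := det_cayley_mul_det A h
  rw [det_one_add_fin_two] at hd
  have hδ := det_one_sub_fin_two A
  set τ := ((1 + A) * (1 - A)⁻¹).trace
  set d := ((1 + A) * (1 - A)⁻¹).det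
  set δ := (1 - A).det
  calc (τ ^ 2 - 4 * d) * δ ^ 2 = (τ * δ) ^ 2 - 4 * (d * δ) * δ := by ring
    _ = (2 - 2 * A.det) ^ 2 - 4 * (1 + A.trace + A.det) * (1 - A.trace + A.det) := by rw [ht, hd, hδ]
    _ = 4 * (A.trace ^ 2 - 4 * A.det) := by ring

/-- **`D_G`-shaped corollary** (`2 × 2`, `det`-exponent `1`): `disc χ_{c(X)} · (det(1 − X)·det(1 + X)) = 4 · disc χ_X · det c(X)`.
[cite: Rogawski1990, §4.9 p. 54] [cite: PlatonovRapinchuk1994, §3.3] -/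
theorem discr_charpoly_cayley_mul_det_mul_det_fin_two (A : Matrix (Fin 2) (Fin 2) R) (h : IsUnit (1 - A).det) :
    ((1 + A) * (1 - A)⁻¹).charpoly.discr * ((1 - A).det * (1 + A).det) = 4 * A.charpoly.discr * ((1 + A) * (1 - A)⁻¹).det := by
  rw [← det_cayley_mul_det A h, ← discr_charpoly_cayley_mul_det_sq_fin_two A h]
  ring

end Ring

section Field

variable {K : Type*} [Field K] [ValuativeRel K] [TopologicalSpace K] [IsNonarchimedeanLocalField K]

/-- **The Weyl ratio `‖disc χ_M‖ · ‖det M‖⁻¹` of a `2 × 2` matrix is invariant under non-zero scalars** (both scale by `‖z‖²`). [cite: Rogawski1990, §4.9 p. 54] -/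
theorem weylRatio_smul_fin_two {z : K} (hz : z ≠ 0) (M : Matrix (Fin 2) (Fin 2) K) :
    normAbs K (z • M).charpoly.discr * (normAbs K (z • M).det)⁻¹ = normAbs K M.charpoly.discr * (normAbs K M.det)⁻¹ := by
  rw [discr_charpoly_smul_fin_two, Matrix.det_smul, Fintype.card_fin, map_mul, map_mul, map_pow]
  have hN : normAbs K z ≠ 0 := (map_ne_zero (normAbs K)).2 hz
  rw [mul_inv, ← mul_assoc, mul_comm (normAbs K z ^ 2), mul_assoc (normAbs K M.charpoly.discr), mul_inv_cancel₀ (pow_ne_zero _ hN), mul_one]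

/-- **The Weyl ratio through the Cayley map** (`2 × 2`): for `1 ± X` invertible,
`(‖disc χ_{c X}‖ · ‖det c X‖⁻¹) · ‖det(1−X) det(1+X)‖ = ‖2‖² · ‖disc χ_X‖`, `c X = (1 + X)(1 − X)⁻¹`. [cite: PlatonovRapinchuk1994, §3.3] [cite: Rogawski1990, §4.9 p. 54] -/
theorem weylRatio_cayley_mul_fin_two {X : Matrix (Fin 2) (Fin 2) K} (hm : IsUnit (1 - X).det) (hp : IsUnit (1 + X).det) :
    normAbs K (cayley X).charpoly.discr * (normAbs K (cayley X).det)⁻¹ * normAbs K ((1 - X).det * (1 + X).det) =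
      (normAbs K 2) ^ 2 * normAbs K X.charpoly.discr := by
  have hdet : (cayley X).det ≠ 0 := by
    rw [cayley_def, Matrix.det_mul, Matrix.det_nonsing_inv, Ring.inverse_eq_inv']
    exact mul_ne_zero hp.ne_zero (inv_ne_zero hm.ne_zero)
  have hNd : normAbs K (cayley X).det ≠ 0 := (map_ne_zero (normAbs K)).2 hdet
  have key := congrArg (normAbs K) (discr_charpoly_cayley_mul_det_mul_det_fin_two X hm)
  rw [← cayley_def] at key
  simp only [map_mul] at key
  have h4 : normAbs K (4 : K) = (normAbs K 2) ^ 2 := by rw [show (4 : K) = 2 ^ 2 by norm_num, map_pow]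
  rw [h4] at key
  calc normAbs K (cayley X).charpoly.discr * (normAbs K (cayley X).det)⁻¹ * normAbs K ((1 - X).det * (1 + X).det)
      = normAbs K (cayley X).charpoly.discr * (normAbs K (1 - X).det * normAbs K (1 + X).det) * (normAbs K (cayley X).det)⁻¹ := by rw [map_mul]; ring
    _ = (normAbs K 2) ^ 2 * normAbs K X.charpoly.discr * normAbs K (cayley X).det * (normAbs K (cayley X).det)⁻¹ := by rw [key]
    _ = (normAbs K 2) ^ 2 * normAbs K X.charpoly.discr := by rw [mul_assoc, mul_inv_cancel₀ hNd, mul_one]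

end Field

/-! ## §2 `ℝ≥0∞` bookkeeping: `θ₂(z • c X) ≤ C(X) · ηι(X)` -/

section Bound

/-- `√√u · √√p = √t · √√a` from `u · p = t² · a` in `ℝ≥0`. [cite: Rogawski1990, §4.9 p. 54] -/
theorem sqrt_sqrt_mul_sqrt_sqrt_eq {u p t a : ℝ≥0} (h : u * p = t ^ 2 * a) :
    NNReal.sqrt (NNReal.sqrt u) * NNReal.sqrt (NNReal.sqrt p) = NNReal.sqrt t * NNReal.sqrt (NNReal.sqrt a) := by
  have h1 : NNReal.sqrt (NNReal.sqrt (u * p)) = NNReal.sqrt (NNReal.sqrt (t ^ 2 * a)) := by rw [h]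
  rwa [NNReal.sqrt_mul, NNReal.sqrt_mul, NNReal.sqrt_mul, NNReal.sqrt_mul, NNReal.sqrt_sq] at h1

/-- `(√√u)⁻¹ ≤ (√√p ∕ √t) · (√√a)⁻¹` in `[0, ∞]` (the case `a = 0` being `⊤ = ⊤`), for `u · p = t² · a`, `p, t ≠ 0`. [cite: Rogawski1990, §4.9 p. 54] -/
theorem inv_sqrt_sqrt_le_two {u p t a : ℝ≥0} (h : u * p = t ^ 2 * a) (hp : p ≠ 0) (ht : t ≠ 0) :
    ((NNReal.sqrt (NNReal.sqrt u) : ℝ≥0∞))⁻¹ ≤ (NNReal.sqrt (NNReal.sqrt p) / NNReal.sqrt t : ℝ≥0) * ((NNReal.sqrt (NNReal.sqrt a) : ℝ≥0∞))⁻¹ := by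
  have hsp : NNReal.sqrt (NNReal.sqrt p) ≠ 0 := by rwa [ne_eq, NNReal.sqrt_eq_zero, NNReal.sqrt_eq_zero]
  have hst : NNReal.sqrt t ≠ 0 := by rwa [ne_eq, NNReal.sqrt_eq_zero]
  by_cases ha : a = 0
  · subst ha
    rw [NNReal.sqrt_zero, NNReal.sqrt_zero, ENNReal.coe_zero, ENNReal.inv_zero, ENNReal.mul_top (by exact_mod_cast div_ne_zero hsp hst)]
    exact le_top
  have hsa : NNReal.sqrt (NNReal.sqrt a) ≠ 0 := by rwa [ne_eq, NNReal.sqrt_eq_zero, NNReal.sqrt_eq_zero]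
  have hS := sqrt_sqrt_mul_sqrt_sqrt_eq h
  have hSu : NNReal.sqrt (NNReal.sqrt u) = NNReal.sqrt t * NNReal.sqrt (NNReal.sqrt a) / NNReal.sqrt (NNReal.sqrt p) := by
    rw [eq_div_iff hsp, hS]
  have hSu0 : NNReal.sqrt (NNReal.sqrt u) ≠ 0 := by rw [hSu]; exact div_ne_zero (mul_ne_zero hst hsa) hsp
  rw [← ENNReal.coe_inv hSu0, ← ENNReal.coe_inv hsa, ← ENNReal.coe_mul, ENNReal.coe_le_coe, hSu, inv_div]
  apply le_of_eq
  rw [div_eq_mul_inv, div_eq_mul_inv, mul_inv, mul_assoc]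

variable {K : Type*} [Field K] [ValuativeRel K] [TopologicalSpace K] [IsNonarchimedeanLocalField K]

/-- **`θ₂(z • c X) ≤ C(X) · ηι(X)`** (`2 × 2`): for `z ≠ 0` and `1 ± X` invertible,
`(↑√√(‖disc χ_M‖·‖det M‖⁻¹))⁻¹ ≤ (√√‖det(1−X)det(1+X)‖ ∕ √‖2‖) · (↑√√‖disc χ_X‖)⁻¹` with `M = z • c(X)` (§1 + `inv_sqrt_sqrt_le_two`; `2 ≠ 0`).
[cite: Rogawski1990, §4.9 p. 54] [cite: PlatonovRapinchuk1994, §3.3] -/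
theorem theta_two_smul_cayley_le (h2 : (2 : K) ≠ 0) {z : K} (hz : z ≠ 0) {X : Matrix (Fin 2) (Fin 2) K} (hm : IsUnit (1 - X).det)
    (hp : IsUnit (1 + X).det) :
    ((NNReal.sqrt (NNReal.sqrt (normAbs K (z • cayley X).charpoly.discr * (normAbs K (z • cayley X).det)⁻¹)) : ℝ≥0) : ℝ≥0∞)⁻¹ ≤
      ((NNReal.sqrt (NNReal.sqrt (normAbs K ((1 - X).det * (1 + X).det))) / NNReal.sqrt (normAbs K 2) : ℝ≥0) : ℝ≥0∞) *
        ((NNReal.sqrt (NNReal.sqrt (normAbs K X.charpoly.discr)) : ℝ≥0) : ℝ≥0∞)⁻¹ := by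
  rw [weylRatio_smul_fin_two hz]
  exact inv_sqrt_sqrt_le_two (weylRatio_cayley_mul_fin_two hm hp) ((map_ne_zero (normAbs K)).2 (mul_ne_zero hm.ne_zero hp.ne_zero))
    ((map_ne_zero (normAbs K)).2 h2)

end Bound

end Summit.HodgeConjecture.HodgeConjecture.Cruxes.H413.K2E3U11WeylDiscrCayleyAlgebra

end
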